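import Literature.MathematicalPhysics.QuantumLattice.ShibaFreeThermalKernel
import Literature.MathematicalPhysics.QuantumLattice.FreeFermionSpinTwistedTraceFormula
import HarnessLib

/-!
# Decay of the thermal kernel of the Shiba-transformed sourced torus, uniformly in the volume

The one-body operator of the Shiba/Lieb-transformed `d`-wave–sourced Hubbard torus,
`𝓚 = shibaOneBody τ_L Δ_{L,h} μ U` (`DWaveSourceDysonSeries.hasSum_partitionFn_dWaveSourceTorus_det`), is the
free Nambu operator `h₀ = bdgNambuMatrix τ_L 0 μ` (whose thermal kernel decays uniformly in `L`,
`ShibaFreeThermalKernel.norm_shibaFreeKernel_apply_le`) plus the ONE-BODY perturbation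
`V = 𝓚 - h₀`: the pair source as a spin-flip nearest-neighbour hopping of size `≤ √2|h|` and the
Hartree term `U·P_↑`. By the stability theorem of `ThermalPropagatorDysonEquation`
(`Matrix.norm_thermalKernel_apply_le_of_subconvolutive`) the thermal kernel
`Γ_𝓚(τ) = e^{-τ𝓚}(1+e^{-β𝓚})⁻¹` keeps the decay of the free one as long as `β c < 1`, `c ∝ |U| + |h|`:

* `Torus.inv_pow_le_of_shift`, `Torus.sum_inv_pow_mul_inv_pow_le` — the weight
  `g(u) = (1 + |u|_L)^{-K}` on the discrete torus is stable under unit shifts (`g(u) ≤ 2^K g(u+e)`,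
  `|e|_L ≤ 1`) and sub-convolutive (`Σ_z g(a-z)g(z-b) ≤ 2^{K+1} S_L g(a-b)`, `S_L = Σ_z g(z)`);
* `norm_dWavePairing_le`, `norm_shibaPerturbation_apply_le` — `|V_{(x,σ),(y,σ')}| ≤ |U|[x=y] + |Δ_h(x,y)| + |Δ_h(y,x)|`,
  `|Δ_h(x,y)| ≤ √2|h| Σ_i [y = x + e_i]`;
* `sum_norm_shibaPerturbation_mul_weight_le`, `shibaPerturbation_subconvolutive` — the constant
  `c = 2^{K+2} C S_L (2|U| + 2^{K+3}√2|h|)` of the stability theorem;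
* **`exists_norm_shibaThermalKernel_apply_le`** — for every `β ≥ 0` and `μ` there are `κ > 0` and
  `C' ≥ 0` such that for all `L ≥ 3`, `|h| ≤ κ`, `|U| ≤ κ`, `τ ∈ [0, β]` and orbitals,
  `‖Γ_𝓚(τ) (v,σ') (u,σ)‖ ≤ C' (1 + |v̄ - ū|_L)^{-4}` — the line bound of the single-scale expansion of
  the SOURCED torus around its BdG–Shiba propagator.

Everything is PROVED; no definition and no named fact.

## References

* G. Benfatto, A. Giuliani, V. Mastropietro, Ann. Henri Poincaré 7 (2006) 809–898, §2.2 (the decay of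
  the free propagator feeding (2.77)). [cite: BenfattoGiulianiMastropietro2006, §2.2]
* A. L. Fetter, J. D. Walecka, *Quantum Theory of Many-Particle Systems* (1971), §25 (Dyson's
  equation for the temperature Green's function). [cite: FetterWalecka1971, §25]
-/

noncomputable section

open scoped Matrix.Norms.L2Operator ComplexOrder
open Finset MeasureTheory Filter Topology NormedSpace Set
open Literature.Probability.LatticeModels

namespace Literature.MathematicalPhysics.QuantumLattice

-- On `Orb (FermionTorus 2 L)` and `FermionTorus 2 L` two `DecidableEq` instance paths meet (the concrete
-- `instDecidableEqLex` and the generic lemmas' `LinearOrder.toDecidableEq`, equal only propositionally);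
-- as in `ShibaFreeThermalKernel` we work on the generic path throughout this file.
attribute [-instance] instDecidableEqLex

/-! ### §1 The weight `(1 + |u|_L)^{-K}` on the discrete torus -/

section Weight

variable {L : ℕ} [NeZero L] (K : ℕ)

/-- **Stability under short shifts**: `(1+|u|)^{-K} ≤ 2^K (1+|u+e|)^{-K}` if `|e|_L ≤ 1`. [folklore] -/
theorem Torus.inv_pow_le_of_shift (u e : TorusSite 2 L) (he : Torus.tnorm e ≤ 1) :
    ((1 + (Torus.tnorm u : ℝ)) ^ K)⁻¹ ≤ (2 : ℝ) ^ K * ((1 + (Torus.tnorm (u + e) : ℝ)) ^ K)⁻¹ := by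
  have h1 : (Torus.tnorm (u + e) : ℝ) ≤ Torus.tnorm u + 1 := by
    have := Torus.tnorm_add_le u e
    have h' : (Torus.tnorm (u + e) : ℝ) ≤ (Torus.tnorm u : ℝ) + (Torus.tnorm e : ℝ) := by exact_mod_cast this
    have he' : (Torus.tnorm e : ℝ) ≤ 1 := by exact_mod_cast he
    linarith
  have h2 : (1 + (Torus.tnorm (u + e) : ℝ)) ^ K ≤ (2 : ℝ) ^ K * (1 + (Torus.tnorm u : ℝ)) ^ K := by
    rw [← mul_pow]
    exact pow_le_pow_left₀ (by positivity) (by linarith) K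
  have hpos : 0 < (1 + (Torus.tnorm (u + e) : ℝ)) ^ K := by positivity
  have h3 : ((2 : ℝ) ^ K * (1 + (Torus.tnorm u : ℝ)) ^ K)⁻¹ ≤ ((1 + (Torus.tnorm (u + e) : ℝ)) ^ K)⁻¹ :=
    inv_anti₀ hpos h2
  have h2K : (2 : ℝ) ^ K ≠ 0 := by positivity
  calc ((1 + (Torus.tnorm u : ℝ)) ^ K)⁻¹
      = (2 : ℝ) ^ K * ((2 : ℝ) ^ K * (1 + (Torus.tnorm u : ℝ)) ^ K)⁻¹ := by
        rw [mul_inv, ← mul_assoc, mul_inv_cancel₀ h2K, one_mul]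
    _ ≤ (2 : ℝ) ^ K * ((1 + (Torus.tnorm (u + e) : ℝ)) ^ K)⁻¹ := mul_le_mul_of_nonneg_left h3 (by positivity)

/-- **Sub-convolutivity**: `Σ_z (1+|a-z|)^{-K}(1+|z-b|)^{-K} ≤ 2^{K+1} S_L (1+|a-b|)^{-K}`,
`S_L = Σ_z (1+|z|)^{-K}`. [folklore] -/
theorem Torus.sum_inv_pow_mul_inv_pow_le (a b : TorusSite 2 L) :
    ∑ z : TorusSite 2 L, ((1 + (Torus.tnorm (a - z) : ℝ)) ^ K)⁻¹ * ((1 + (Torus.tnorm (z - b) : ℝ)) ^ K)⁻¹ ≤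
      (2 : ℝ) ^ (K + 1) * (∑ z : TorusSite 2 L, ((1 + (Torus.tnorm z : ℝ)) ^ K)⁻¹) *
        ((1 + (Torus.tnorm (a - b) : ℝ)) ^ K)⁻¹ := by
  set g : TorusSite 2 L → ℝ := fun u => ((1 + (Torus.tnorm u : ℝ)) ^ K)⁻¹ with hg
  have hg0 : ∀ u, 0 ≤ g u := fun u => by positivity
  -- pointwise: each term is at most `2^K g(a-b) (g(z-b) + g(a-z))`
  have hpt : ∀ z, g (a - z) * g (z - b) ≤ (2 : ℝ) ^ K * g (a - b) * (g (z - b) + g (a - z)) := by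
    intro z
    have htri : (Torus.tnorm (a - b) : ℝ) ≤ Torus.tnorm (a - z) + Torus.tnorm (z - b) := by
      have := Torus.tnorm_add_le (a - z) (z - b)
      rw [show a - z + (z - b) = a - b by abel] at this
      exact_mod_cast this
    -- the larger of the two distances dominates half of `|a - b|`
    have hhalf : ∀ (p : TorusSite 2 L), (Torus.tnorm (a - b) : ℝ) ≤ 2 * Torus.tnorm p →
        g p ≤ (2 : ℝ) ^ K * g (a - b) := by
      intro p hp
      simp only [hg]
      have hpos' : 0 < (1 + (Torus.tnorm (a - b) : ℝ)) ^ K := by positivity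
      have h2 : (1 + (Torus.tnorm (a - b) : ℝ)) ^ K ≤ (2 : ℝ) ^ K * (1 + (Torus.tnorm p : ℝ)) ^ K := by
        rw [← mul_pow]
        exact pow_le_pow_left₀ (by positivity) (by linarith) K
      have h3 : ((2 : ℝ) ^ K * (1 + (Torus.tnorm p : ℝ)) ^ K)⁻¹ ≤ ((1 + (Torus.tnorm (a - b) : ℝ)) ^ K)⁻¹ :=
        inv_anti₀ hpos' h2
      have h2K : (2 : ℝ) ^ K ≠ 0 := by positivity
      calc ((1 + (Torus.tnorm p : ℝ)) ^ K)⁻¹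
          = (2 : ℝ) ^ K * ((2 : ℝ) ^ K * (1 + (Torus.tnorm p : ℝ)) ^ K)⁻¹ := by
            rw [mul_inv, ← mul_assoc, mul_inv_cancel₀ h2K, one_mul]
        _ ≤ (2 : ℝ) ^ K * ((1 + (Torus.tnorm (a - b) : ℝ)) ^ K)⁻¹ := mul_le_mul_of_nonneg_left h3 (by positivity)
    rcases le_total (Torus.tnorm (z - b) : ℝ) (Torus.tnorm (a - z)) with hle | hle
    · have h1 : g (a - z) ≤ (2 : ℝ) ^ K * g (a - b) := hhalf _ (by linarith)
      calc g (a - z) * g (z - b) ≤ (2 : ℝ) ^ K * g (a - b) * g (z - b) :=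
            mul_le_mul_of_nonneg_right h1 (hg0 _)
        _ ≤ (2 : ℝ) ^ K * g (a - b) * (g (z - b) + g (a - z)) := by
            refine mul_le_mul_of_nonneg_left ?_ (by positivity)
            linarith [hg0 (a - z)]
    · have h1 : g (z - b) ≤ (2 : ℝ) ^ K * g (a - b) := hhalf _ (by linarith)
      calc g (a - z) * g (z - b) ≤ g (a - z) * ((2 : ℝ) ^ K * g (a - b)) :=
            mul_le_mul_of_nonneg_left h1 (hg0 _)
        _ = (2 : ℝ) ^ K * g (a - b) * g (a - z) := by ring
        _ ≤ (2 : ℝ) ^ K * g (a - b) * (g (z - b) + g (a - z)) := by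
            refine mul_le_mul_of_nonneg_left ?_ (by positivity)
            linarith [hg0 (z - b)]
  -- sum, and translation invariance of the two sums
  have hS₁ : ∑ z : TorusSite 2 L, g (z - b) = ∑ z : TorusSite 2 L, g z :=
    Fintype.sum_equiv (Equiv.subRight b) _ _ fun z => rfl
  have hS₂ : ∑ z : TorusSite 2 L, g (a - z) = ∑ z : TorusSite 2 L, g z :=
    Fintype.sum_equiv (Equiv.subLeft a) _ _ fun z => rfl
  calc ∑ z, g (a - z) * g (z - b) ≤ ∑ z, (2 : ℝ) ^ K * g (a - b) * (g (z - b) + g (a - z)) := sum_le_sum fun z _ => hpt z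
    _ = (2 : ℝ) ^ K * g (a - b) * (∑ z, g (z - b) + ∑ z, g (a - z)) := by
        rw [← Finset.mul_sum, Finset.sum_add_distrib]
    _ = (2 : ℝ) ^ (K + 1) * (∑ z, g z) * g (a - b) := by rw [hS₁, hS₂, pow_succ]; ring

end Weight

/-! ### §2 The perturbation `V = 𝓚 - h₀`: pair source and Hartree term -/

section Perturbation

variable {L : ℕ} [NeZero L]

/-- The `d`-wave bond pairing of strength `h` is at most `√2|h|` on forward bonds and zero elsewhere:
`|Δ_h(x,y)| ≤ √2|h| Σ_i [y = x + e_i]`. [folklore] -/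
theorem norm_dWavePairing_le (h : ℝ) (x y : FermionTorus 2 L) :
    ‖-(h : ℂ) * ∑ i : Fin 2, (if y = FermionTorus.ofTorusSite (x.toTorusSite + Pi.single i 1) then
        ((Real.sqrt 2 * (if i = 0 then 1 else -1) : ℝ) : ℂ) else 0)‖ ≤
      Real.sqrt 2 * |h| * ∑ i : Fin 2,
        (if y = FermionTorus.ofTorusSite (x.toTorusSite + Pi.single i 1) then (1 : ℝ) else 0) := by
  rw [norm_mul, norm_neg, Complex.norm_real, Real.norm_eq_abs]
  have hterm : ∀ i : Fin 2,
      ‖(if y = FermionTorus.ofTorusSite (x.toTorusSite + Pi.single i 1) then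
        ((Real.sqrt 2 * (if i = 0 then 1 else -1) : ℝ) : ℂ) else 0)‖ ≤
        Real.sqrt 2 * (if y = FermionTorus.ofTorusSite (x.toTorusSite + Pi.single i 1) then (1 : ℝ) else 0) := by
    intro i
    split_ifs <;> simp [abs_of_nonneg (Real.sqrt_nonneg 2)]
  calc |h| * ‖∑ i : Fin 2, (if y = FermionTorus.ofTorusSite (x.toTorusSite + Pi.single i 1) then
          ((Real.sqrt 2 * (if i = 0 then 1 else -1) : ℝ) : ℂ) else 0)‖
      ≤ |h| * ∑ i : Fin 2, Real.sqrt 2 *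
          (if y = FermionTorus.ofTorusSite (x.toTorusSite + Pi.single i 1) then (1 : ℝ) else 0) :=
        mul_le_mul_of_nonneg_left ((norm_sum_le _ _).trans (sum_le_sum fun i _ => hterm i)) (abs_nonneg h)
    _ = Real.sqrt 2 * |h| * ∑ i : Fin 2,
          (if y = FermionTorus.ofTorusSite (x.toTorusSite + Pi.single i 1) then (1 : ℝ) else 0) := by
        rw [Finset.mul_sum, Finset.mul_sum]
        exact sum_congr rfl fun i _ => by ring

/-- **Entries of the perturbation** `V = shibaOneBody τ Δ μ U - bdgNambuMatrix τ 0 μ` (any finite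
lattice, any hopping `τ`, any pairing `Δ`): the Hartree term on the spin-up diagonal and the pairing as
a spin-flip hopping. [folklore] -/
theorem shibaPerturbation_orb_orb {Λ : Type*} [LinearOrder Λ] [Fintype Λ]
    (τ Δ : Λ → Λ → ℂ) (μ U : ℝ) (x y : Λ) (σ σ' : Fin 2) :
    (shibaOneBody τ Δ μ (U : ℂ) - bdgNambuMatrix τ (fun _ _ => (0 : ℂ)) μ) (orb x σ) (orb y σ') =
      if σ = 0 then (if σ' = 0 then (if x = y then (U : ℂ) else 0) else -star (Δ x y + Δ y x))
      else (if σ' = 0 then -(Δ x y + Δ y x) else 0) := by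
  rw [Matrix.sub_apply, shibaOneBody_eq, Matrix.add_apply, bdgNambuMatrix_orb_orb, bdgNambuMatrix_orb_orb,
    Matrix.diagonal_apply]
  simp only [orb, ofLex_toLex, toLex_inj, Prod.mk.injEq]
  fin_cases σ <;> fin_cases σ' <;> by_cases hxy : x = y <;> simp [hxy]

/-- Hence `|V_{(x,σ),(y,σ')}| ≤ |U|[x = y] + |Δ(x,y)| + |Δ(y,x)|`. [folklore] -/
theorem norm_shibaPerturbation_apply_le {Λ : Type*} [LinearOrder Λ] [Fintype Λ]
    (τ Δ : Λ → Λ → ℂ) (μ U : ℝ) (x y : Λ) (σ σ' : Fin 2) :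
    ‖(shibaOneBody τ Δ μ (U : ℂ) - bdgNambuMatrix τ (fun _ _ => (0 : ℂ)) μ) (orb x σ) (orb y σ')‖ ≤
      |U| * (if x = y then (1 : ℝ) else 0) + ‖Δ x y‖ + ‖Δ y x‖ := by
  rw [shibaPerturbation_orb_orb]
  have h1 := norm_add_le (Δ x y) (Δ y x)
  have h2 := norm_nonneg (Δ x y)
  have h3 := norm_nonneg (Δ y x)
  have h4 := abs_nonneg U
  split_ifs <;>
    simp only [norm_neg, norm_star, norm_zero, Complex.norm_real, Real.norm_eq_abs, mul_one, mul_zero] <;>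
    linarith

end Perturbation

/-! ### §3 Sub-convolutivity of the weight through `|V|` on the torus -/

section Subconvolutive

variable {L : ℕ} [NeZero L]

/-- `x = y ⊕ e ↔ y = x ⊖ e` on the fermionic torus. [folklore] -/
theorem eq_ofTorusSite_add_iff (x y : FermionTorus 2 L) (e : TorusSite 2 L) :
    x = FermionTorus.ofTorusSite (y.toTorusSite + e) ↔ y = FermionTorus.ofTorusSite (x.toTorusSite - e) := by
  constructor
  · rintro rfl
    rw [FermionTorus.toTorusSite_ofTorusSite, add_sub_cancel_right, FermionTorus.ofTorusSite_toTorusSite]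
  · rintro rfl
    rw [FermionTorus.toTorusSite_ofTorusSite, sub_add_cancel, FermionTorus.ofTorusSite_toTorusSite]

/-- **The inner sum**: for the Shiba perturbation `V` of the sourced torus, the weight
`g(u) = (1+|u|_L)^{-K}` and every orbital `k = (x,σ)` and torus point `b`,
`Σ_l |V k l| g(l̄ - b) ≤ (2|U| + 2^{K+3}√2|h|) g(x̄ - b)`. [folklore] -/
theorem sum_norm_shibaPerturbation_mul_weight_le (K : ℕ) (μ h U : ℝ) (x : FermionTorus 2 L) (σ : Fin 2)
    (b : TorusSite 2 L) :
    ∑ l : Orb (FermionTorus 2 L),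
        ‖(shibaOneBody (fun x y : FermionTorus 2 L => if (fermionTorusGraph 2 L).Adj x y then -(1 : ℂ) else 0)
            (fun u v : FermionTorus 2 L => -(h : ℂ) * ∑ i : Fin 2,
              if v = FermionTorus.ofTorusSite (u.toTorusSite + Pi.single i 1) then
                ((Real.sqrt 2 * (if i = 0 then 1 else -1) : ℝ) : ℂ) else 0) μ (U : ℂ) -
          bdgNambuMatrix (fun x y : FermionTorus 2 L => if (fermionTorusGraph 2 L).Adj x y then -(1 : ℂ) else 0)
            (fun _ _ => (0 : ℂ)) μ) (orb x σ) l‖ *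
          ((1 + (Torus.tnorm (FermionTorus.toTorusSite (ofLex l).1 - b) : ℝ)) ^ K)⁻¹ ≤
      (2 * |U| + (2 : ℝ) ^ (K + 3) * Real.sqrt 2 * |h|) *
        ((1 + (Torus.tnorm (x.toTorusSite - b) : ℝ)) ^ K)⁻¹ := by
  set g : TorusSite 2 L → ℝ := fun u => ((1 + (Torus.tnorm u : ℝ)) ^ K)⁻¹ with hg
  have hg0 : ∀ u, 0 ≤ g u := fun u => by positivity
  set Δ : FermionTorus 2 L → FermionTorus 2 L → ℂ := fun u v => -(h : ℂ) * ∑ i : Fin 2,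
    if v = FermionTorus.ofTorusSite (u.toTorusSite + Pi.single i 1) then
      ((Real.sqrt 2 * (if i = 0 then 1 else -1) : ℝ) : ℂ) else 0 with hΔ
  set V : Matrix (Orb (FermionTorus 2 L)) (Orb (FermionTorus 2 L)) ℂ :=
    shibaOneBody (fun x y : FermionTorus 2 L => if (fermionTorusGraph 2 L).Adj x y then -(1 : ℂ) else 0) Δ μ (U : ℂ) -
      bdgNambuMatrix (fun x y : FermionTorus 2 L => if (fermionTorusGraph 2 L).Adj x y then -(1 : ℂ) else 0)
        (fun _ _ => (0 : ℂ)) μ with hV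
  -- shifts by `± e_i`
  have hshift₁ : ∀ i : Fin 2, g (x.toTorusSite + Pi.single i 1 - b) ≤ (2 : ℝ) ^ K * g (x.toTorusSite - b) := by
    intro i
    have he' : Torus.tnorm (-(Pi.single i 1 : TorusSite 2 L)) ≤ 1 :=
      (Torus.tnorm_neg_le _).trans (Torus.tnorm_single_le (d := 2) (L := L) i)
    have := Torus.inv_pow_le_of_shift K (x.toTorusSite + Pi.single i 1 - b) (-(Pi.single i 1)) he'
    rwa [show x.toTorusSite + Pi.single i 1 - b + -Pi.single i 1 = x.toTorusSite - b by abel] at this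
  have hshift₂ : ∀ i : Fin 2, g (x.toTorusSite - Pi.single i 1 - b) ≤ (2 : ℝ) ^ K * g (x.toTorusSite - b) := by
    intro i
    have := Torus.inv_pow_le_of_shift K (x.toTorusSite - Pi.single i 1 - b) (Pi.single i 1)
      (Torus.tnorm_single_le (d := 2) (L := L) i)
    rwa [show x.toTorusSite - Pi.single i 1 - b + Pi.single i 1 = x.toTorusSite - b by abel] at this
  -- the norms of the pairing, summed against the weight
  have hpair₁ : ∑ y : FermionTorus 2 L, ‖Δ x y‖ * g (y.toTorusSite - b) ≤
      Real.sqrt 2 * |h| * ∑ i : Fin 2, g (x.toTorusSite + Pi.single i 1 - b) := by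
    calc ∑ y : FermionTorus 2 L, ‖Δ x y‖ * g (y.toTorusSite - b)
        ≤ ∑ y : FermionTorus 2 L, (Real.sqrt 2 * |h| * ∑ i : Fin 2,
            (if y = FermionTorus.ofTorusSite (x.toTorusSite + Pi.single i 1) then (1 : ℝ) else 0)) *
            g (y.toTorusSite - b) :=
          sum_le_sum fun y _ => mul_le_mul_of_nonneg_right (norm_dWavePairing_le (L := L) h x y) (hg0 _)
      _ = Real.sqrt 2 * |h| * ∑ i : Fin 2, ∑ y : FermionTorus 2 L,
            (if y = FermionTorus.ofTorusSite (x.toTorusSite + Pi.single i 1) then (1 : ℝ) else 0) *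
              g (y.toTorusSite - b) := by
          rw [Finset.sum_comm, Finset.mul_sum]
          refine sum_congr rfl fun y _ => ?_
          rw [Finset.mul_sum, Finset.mul_sum, Finset.sum_mul]
          refine sum_congr rfl fun i _ => ?_
          ring
      _ = Real.sqrt 2 * |h| * ∑ i : Fin 2, g (x.toTorusSite + Pi.single i 1 - b) := by
          congr 1
          refine sum_congr rfl fun i _ => ?_
          rw [Finset.sum_eq_single (FermionTorus.ofTorusSite (x.toTorusSite + Pi.single i 1))]
          · rw [if_pos rfl, one_mul, FermionTorus.toTorusSite_ofTorusSite]
          · intro y _ hy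
            rw [if_neg hy, zero_mul]
          · intro hy; exact absurd (Finset.mem_univ _) hy
  have hpair₂ : ∑ y : FermionTorus 2 L, ‖Δ y x‖ * g (y.toTorusSite - b) ≤
      Real.sqrt 2 * |h| * ∑ i : Fin 2, g (x.toTorusSite - Pi.single i 1 - b) := by
    calc ∑ y : FermionTorus 2 L, ‖Δ y x‖ * g (y.toTorusSite - b)
        ≤ ∑ y : FermionTorus 2 L, (Real.sqrt 2 * |h| * ∑ i : Fin 2,
            (if x = FermionTorus.ofTorusSite (y.toTorusSite + Pi.single i 1) then (1 : ℝ) else 0)) *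
            g (y.toTorusSite - b) :=
          sum_le_sum fun y _ => mul_le_mul_of_nonneg_right (norm_dWavePairing_le (L := L) h y x) (hg0 _)
      _ = Real.sqrt 2 * |h| * ∑ i : Fin 2, ∑ y : FermionTorus 2 L,
            (if x = FermionTorus.ofTorusSite (y.toTorusSite + Pi.single i 1) then (1 : ℝ) else 0) *
              g (y.toTorusSite - b) := by
          rw [Finset.sum_comm, Finset.mul_sum]
          refine sum_congr rfl fun y _ => ?_
          rw [Finset.mul_sum, Finset.mul_sum, Finset.sum_mul]
          refine sum_congr rfl fun i _ => ?_
          ring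
      _ = Real.sqrt 2 * |h| * ∑ i : Fin 2, g (x.toTorusSite - Pi.single i 1 - b) := by
          congr 1
          refine sum_congr rfl fun i _ => ?_
          rw [Finset.sum_eq_single (FermionTorus.ofTorusSite (x.toTorusSite - Pi.single i 1))]
          · rw [if_pos ((eq_ofTorusSite_add_iff x _ _).2 rfl), one_mul, FermionTorus.toTorusSite_ofTorusSite]
          · intro y _ hy
            rw [if_neg (fun hxy => hy ((eq_ofTorusSite_add_iff x y _).1 hxy)), zero_mul]
          · intro hy; exact absurd (Finset.mem_univ _) hy
  have hdiag : ∑ y : FermionTorus 2 L, (|U| * (if x = y then (1 : ℝ) else 0)) * g (y.toTorusSite - b) =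
      |U| * g (x.toTorusSite - b) := by
    rw [Finset.sum_eq_single x]
    · rw [if_pos rfl, mul_one]
    · intro y _ hy
      rw [if_neg (Ne.symm hy), mul_zero, zero_mul]
    · intro hx; exact absurd (Finset.mem_univ _) hx
  -- assemble
  rw [sum_orb_eq_sum_sum]
  calc ∑ y : FermionTorus 2 L, ∑ σ' : Fin 2, ‖V (orb x σ) (orb y σ')‖ * g (FermionTorus.toTorusSite (ofLex (orb y σ')).1 - b)
      ≤ ∑ y : FermionTorus 2 L, ∑ _σ' : Fin 2,
          (|U| * (if x = y then (1 : ℝ) else 0) + ‖Δ x y‖ + ‖Δ y x‖) * g (y.toTorusSite - b) := by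
        refine sum_le_sum fun y _ => sum_le_sum fun σ' _ => ?_
        have hpos : FermionTorus.toTorusSite (ofLex (orb y σ')).1 = y.toTorusSite := rfl
        rw [hpos]
        exact mul_le_mul_of_nonneg_right (norm_shibaPerturbation_apply_le _ Δ μ U x y σ σ') (hg0 _)
    _ = 2 * (∑ y : FermionTorus 2 L, (|U| * (if x = y then (1 : ℝ) else 0)) * g (y.toTorusSite - b) +
          ∑ y : FermionTorus 2 L, ‖Δ x y‖ * g (y.toTorusSite - b) +
          ∑ y : FermionTorus 2 L, ‖Δ y x‖ * g (y.toTorusSite - b)) := by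
        rw [← Finset.sum_add_distrib, ← Finset.sum_add_distrib, Finset.mul_sum]
        refine sum_congr rfl fun y _ => ?_
        rw [Finset.sum_const, Finset.card_univ, Fintype.card_fin, nsmul_eq_mul, Nat.cast_ofNat]
        ring
    _ ≤ 2 * (|U| * g (x.toTorusSite - b) +
          Real.sqrt 2 * |h| * ∑ i : Fin 2, (2 : ℝ) ^ K * g (x.toTorusSite - b) +
          Real.sqrt 2 * |h| * ∑ i : Fin 2, (2 : ℝ) ^ K * g (x.toTorusSite - b)) := by
        rw [hdiag]
        have hs0 : 0 ≤ Real.sqrt 2 * |h| := by positivity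
        have e1 := hpair₁.trans (mul_le_mul_of_nonneg_left (sum_le_sum fun i _ => hshift₁ i) hs0)
        have e2 := hpair₂.trans (mul_le_mul_of_nonneg_left (sum_le_sum fun i _ => hshift₂ i) hs0)
        linarith
    _ = (2 * |U| + (2 : ℝ) ^ (K + 3) * Real.sqrt 2 * |h|) * g (x.toTorusSite - b) := by
        simp only [Finset.sum_const, Finset.card_univ, Fintype.card_fin, nsmul_eq_mul, Nat.cast_ofNat]
        ring

/-- **Sub-convolutivity of the weight through the Shiba perturbation**: with
`w(o,o') = C' g(ō - ō')`, `g(u) = (1+|u|_L)^{-K}`, `S_L = Σ_z g(z)`, for all orbitals `i, j`,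
`Σ_{k,l} w(i,k) |V k l| w(l,j) ≤ c · w(i,j)`, `c = 2^{K+2} C' S_L (2|U| + 2^{K+3}√2|h|)`. [folklore] -/
theorem shibaPerturbation_subconvolutive (K : ℕ) (μ h U C' : ℝ) (hC' : 0 ≤ C')
    (i j : Orb (FermionTorus 2 L)) :
    ∑ k : Orb (FermionTorus 2 L), ∑ l : Orb (FermionTorus 2 L),
        (C' * ((1 + (Torus.tnorm (FermionTorus.toTorusSite (ofLex i).1 -
            FermionTorus.toTorusSite (ofLex k).1) : ℝ)) ^ K)⁻¹) *
          ‖(shibaOneBody (fun x y : FermionTorus 2 L => if (fermionTorusGraph 2 L).Adj x y then -(1 : ℂ) else 0)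
              (fun u v : FermionTorus 2 L => -(h : ℂ) * ∑ i : Fin 2,
                if v = FermionTorus.ofTorusSite (u.toTorusSite + Pi.single i 1) then
                  ((Real.sqrt 2 * (if i = 0 then 1 else -1) : ℝ) : ℂ) else 0) μ (U : ℂ) -
            bdgNambuMatrix (fun x y : FermionTorus 2 L => if (fermionTorusGraph 2 L).Adj x y then -(1 : ℂ) else 0)
              (fun _ _ => (0 : ℂ)) μ) k l‖ *
          (C' * ((1 + (Torus.tnorm (FermionTorus.toTorusSite (ofLex l).1 -
            FermionTorus.toTorusSite (ofLex j).1) : ℝ)) ^ K)⁻¹) ≤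
      ((2 : ℝ) ^ (K + 2) * C' * (∑ z : TorusSite 2 L, ((1 + (Torus.tnorm z : ℝ)) ^ K)⁻¹) *
          (2 * |U| + (2 : ℝ) ^ (K + 3) * Real.sqrt 2 * |h|)) *
        (C' * ((1 + (Torus.tnorm (FermionTorus.toTorusSite (ofLex i).1 -
            FermionTorus.toTorusSite (ofLex j).1) : ℝ)) ^ K)⁻¹) := by
  set g : TorusSite 2 L → ℝ := fun u => ((1 + (Torus.tnorm u : ℝ)) ^ K)⁻¹ with hg
  have hg0 : ∀ u, 0 ≤ g u := fun u => by positivity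
  set V : Matrix (Orb (FermionTorus 2 L)) (Orb (FermionTorus 2 L)) ℂ :=
    shibaOneBody (fun x y : FermionTorus 2 L => if (fermionTorusGraph 2 L).Adj x y then -(1 : ℂ) else 0)
        (fun u v : FermionTorus 2 L => -(h : ℂ) * ∑ i : Fin 2,
          if v = FermionTorus.ofTorusSite (u.toTorusSite + Pi.single i 1) then
            ((Real.sqrt 2 * (if i = 0 then 1 else -1) : ℝ) : ℂ) else 0) μ (U : ℂ) -
      bdgNambuMatrix (fun x y : FermionTorus 2 L => if (fermionTorusGraph 2 L).Adj x y then -(1 : ℂ) else 0)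
        (fun _ _ => (0 : ℂ)) μ with hV
  set A : ℝ := 2 * |U| + (2 : ℝ) ^ (K + 3) * Real.sqrt 2 * |h| with hA
  have hA0 : 0 ≤ A := by positivity
  set a : TorusSite 2 L := FermionTorus.toTorusSite (ofLex i).1 with ha
  set bb : TorusSite 2 L := FermionTorus.toTorusSite (ofLex j).1 with hb
  set SL : ℝ := ∑ z : TorusSite 2 L, g z with hSL
  have hSL0 : 0 ≤ SL := sum_nonneg fun z _ => hg0 z
  -- inner sum over `l`
  have hinner : ∀ k : Orb (FermionTorus 2 L),
      ∑ l : Orb (FermionTorus 2 L), ‖V k l‖ * (C' * g (FermionTorus.toTorusSite (ofLex l).1 - bb)) ≤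
        C' * (A * g (FermionTorus.toTorusSite (ofLex k).1 - bb)) := by
    intro k
    obtain ⟨⟨x, σ⟩, rfl⟩ : ∃ p : FermionTorus 2 L × Fin 2, toLex p = k := ⟨ofLex k, toLex_ofLex k⟩
    have hk : FermionTorus.toTorusSite (ofLex (toLex (x, σ))).1 = x.toTorusSite := rfl
    rw [hk]
    have hmain := sum_norm_shibaPerturbation_mul_weight_le (L := L) K μ h U x σ bb
    have hre : ∑ l : Orb (FermionTorus 2 L), ‖V (toLex (x, σ)) l‖ * (C' * g (FermionTorus.toTorusSite (ofLex l).1 - bb)) =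
        C' * ∑ l : Orb (FermionTorus 2 L), ‖V (orb x σ) l‖ * g (FermionTorus.toTorusSite (ofLex l).1 - bb) := by
      rw [Finset.mul_sum]
      exact sum_congr rfl fun l _ => mul_left_comm _ _ _
    rw [hre]
    exact mul_le_mul_of_nonneg_left hmain hC'
  -- outer sum over `k`
  have houter : ∑ k : Orb (FermionTorus 2 L),
      g (a - FermionTorus.toTorusSite (ofLex k).1) * g (FermionTorus.toTorusSite (ofLex k).1 - bb) =
        2 * ∑ z : TorusSite 2 L, g (a - z) * g (z - bb) := by
    rw [sum_orb_eq_sum_sum]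
    have : ∀ y : FermionTorus 2 L, ∑ _σ : Fin 2,
        g (a - FermionTorus.toTorusSite (ofLex (orb y _σ)).1) * g (FermionTorus.toTorusSite (ofLex (orb y _σ)).1 - bb) =
          2 * (g (a - y.toTorusSite) * g (y.toTorusSite - bb)) := by
      intro y
      simp only [orb, ofLex_toLex, Finset.sum_const, Finset.card_univ, Fintype.card_fin, nsmul_eq_mul,
        Nat.cast_ofNat]
    simp only [this]
    rw [← Finset.mul_sum]
    congr 1
    exact Fintype.sum_equiv
      ⟨FermionTorus.toTorusSite, FermionTorus.ofTorusSite, FermionTorus.ofTorusSite_toTorusSite,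
        FermionTorus.toTorusSite_ofTorusSite⟩ _ _ fun z => rfl
  have hconv : ∑ z : TorusSite 2 L, g (a - z) * g (z - bb) ≤ (2 : ℝ) ^ (K + 1) * SL * g (a - bb) :=
    Torus.sum_inv_pow_mul_inv_pow_le (L := L) K a bb
  have hstep₁ : ∀ k : Orb (FermionTorus 2 L),
      ∑ l, (C' * g (a - FermionTorus.toTorusSite (ofLex k).1)) * ‖V k l‖ *
          (C' * g (FermionTorus.toTorusSite (ofLex l).1 - bb)) ≤
        (C' * g (a - FermionTorus.toTorusSite (ofLex k).1)) * (C' * (A * g (FermionTorus.toTorusSite (ofLex k).1 - bb))) := by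
    intro k
    have hre : ∑ l, (C' * g (a - FermionTorus.toTorusSite (ofLex k).1)) * ‖V k l‖ *
        (C' * g (FermionTorus.toTorusSite (ofLex l).1 - bb)) =
        (C' * g (a - FermionTorus.toTorusSite (ofLex k).1)) *
          ∑ l, ‖V k l‖ * (C' * g (FermionTorus.toTorusSite (ofLex l).1 - bb)) := by
      rw [Finset.mul_sum]
      exact sum_congr rfl fun l _ => by ring
    rw [hre]
    exact mul_le_mul_of_nonneg_left (hinner k) (by positivity)
  have hstep₂ : ∑ k : Orb (FermionTorus 2 L),
      (C' * g (a - FermionTorus.toTorusSite (ofLex k).1)) * (C' * (A * g (FermionTorus.toTorusSite (ofLex k).1 - bb))) =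
        C' * C' * A * (2 * ∑ z : TorusSite 2 L, g (a - z) * g (z - bb)) := by
    rw [← houter, Finset.mul_sum]
    exact sum_congr rfl fun k _ => by ring
  have hfin : C' * C' * A * (2 * ∑ z : TorusSite 2 L, g (a - z) * g (z - bb)) ≤
      ((2 : ℝ) ^ (K + 2) * C' * SL * A) * (C' * g (a - bb)) := by
    have h2 : 2 * ∑ z : TorusSite 2 L, g (a - z) * g (z - bb) ≤ 2 * ((2 : ℝ) ^ (K + 1) * SL * g (a - bb)) := by
      linarith
    calc C' * C' * A * (2 * ∑ z : TorusSite 2 L, g (a - z) * g (z - bb))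
        ≤ C' * C' * A * (2 * ((2 : ℝ) ^ (K + 1) * SL * g (a - bb))) := mul_le_mul_of_nonneg_left h2 (by positivity)
      _ = ((2 : ℝ) ^ (K + 2) * C' * SL * A) * (C' * g (a - bb)) := by rw [pow_succ]; ring
  exact ((sum_le_sum fun k _ => hstep₁ k).trans (le_of_eq hstep₂)).trans hfin

end Subconvolutive

/-! ### §4 The thermal kernel of the sourced torus decays -/

section Decay

variable (β μ : ℝ)

/-- **The thermal kernel of the Shiba-transformed `d`-wave–sourced Hubbard torus decays uniformly in
the volume, for small source and small Hartree term.** For every `β ≥ 0` and `μ` there are `κ > 0`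
and `C' ≥ 0` such that for all `L ≥ 3`, all real `h, U` with `|h| ≤ κ`, `|U| ≤ κ`, all `τ ∈ [0, β]`
and all torus orbitals `(v, σ'), (u, σ)`:
`‖(e^{-τ𝓚}(1 + e^{-β𝓚})⁻¹)_{(v,σ'),(u,σ)}‖ ≤ C' (1 + |v̄ - ū|_L)^{-4}`,
`𝓚 = shibaOneBody τ_L Δ_{L,h} μ U` the one-body operator of `hasSum_partitionFn_dWaveSourceTorus_det`.
(Dyson-equation bootstrap around the free Nambu kernel; `κ, C'` depend on `β, μ` only.)
[cite: BenfattoGiulianiMastropietro2006, §2.2] -/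
theorem exists_norm_shibaThermalKernel_apply_le (hβ : 0 ≤ β) :
    ∃ κ : ℝ, 0 < κ ∧ ∃ C' : ℝ, 0 ≤ C' ∧ ∀ (L : ℕ) [NeZero L], 3 ≤ L → ∀ (h U : ℝ), |h| ≤ κ → |U| ≤ κ →
      ∀ τ ∈ Icc (0 : ℝ) β, ∀ (u v : FermionTorus 2 L) (σ σ' : Fin 2),
        ‖(exp ((-τ) • shibaOneBody
              (fun x y : FermionTorus 2 L => if (fermionTorusGraph 2 L).Adj x y then -(1 : ℂ) else 0)
              (fun u v : FermionTorus 2 L => -(h : ℂ) * ∑ i : Fin 2,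
                if v = FermionTorus.ofTorusSite (u.toTorusSite + Pi.single i 1) then
                  ((Real.sqrt 2 * (if i = 0 then 1 else -1) : ℝ) : ℂ) else 0) μ (U : ℂ)) *
            (1 + exp ((-β) • shibaOneBody
              (fun x y : FermionTorus 2 L => if (fermionTorusGraph 2 L).Adj x y then -(1 : ℂ) else 0)
              (fun u v : FermionTorus 2 L => -(h : ℂ) * ∑ i : Fin 2,
                if v = FermionTorus.ofTorusSite (u.toTorusSite + Pi.single i 1) then
                  ((Real.sqrt 2 * (if i = 0 then 1 else -1) : ℝ) : ℂ) else 0) μ (U : ℂ)))⁻¹)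
            (orb v σ') (orb u σ)‖ ≤
          C' * ((1 + (Torus.tnorm (FermionTorus.toTorusSite v - FermionTorus.toTorusSite u) : ℝ)) ^ 4)⁻¹ := by
  -- decay data of the free propagator, `K = 4`, separations `[-2β, β]`
  obtain ⟨C, hCpos, hC⟩ := exists_norm_hubbardThermalTwoPointEvolved_le_tnZ β μ (-(2 * β)) β (K := 4) le_rfl
  set S : ℝ := ∑' z : Site 2, ((1 + ‖z‖) ^ 4)⁻¹ with hS
  have hS0 : 0 ≤ S := tsum_nonneg fun z => by positivity
  -- the constants: `c ≤ 2^6 C S (2|U| + 2^7 √2 |h|) ≤ 2^6 C S · 200 κ` and `β c ≤ 1/2`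
  set κ : ℝ := (2 * (2 : ℝ) ^ 6 * (C * S + 1) * 200 * (β + 1))⁻¹ with hκ
  have hκpos : 0 < κ := by positivity
  refine ⟨κ, hκpos, 2 * C, by positivity, ?_⟩
  intro L _ hL h U hh hU τ hτ u v σ σ'
  -- abbreviations
  set τL : FermionTorus 2 L → FermionTorus 2 L → ℂ :=
    fun x y => if (fermionTorusGraph 2 L).Adj x y then -(1 : ℂ) else 0 with hτL
  set Δ : FermionTorus 2 L → FermionTorus 2 L → ℂ := fun u v => -(h : ℂ) * ∑ i : Fin 2,
    if v = FermionTorus.ofTorusSite (u.toTorusSite + Pi.single i 1) then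
      ((Real.sqrt 2 * (if i = 0 then 1 else -1) : ℝ) : ℂ) else 0 with hΔ
  set 𝓚 : Matrix (Orb (FermionTorus 2 L)) (Orb (FermionTorus 2 L)) ℂ := shibaOneBody τL Δ μ (U : ℂ) with h𝓚
  set h₀ : Matrix (Orb (FermionTorus 2 L)) (Orb (FermionTorus 2 L)) ℂ :=
    bdgNambuMatrix τL (fun _ _ => (0 : ℂ)) μ with hh₀
  have hτsymm : ∀ x y : FermionTorus 2 L, star (τL x y) = τL y x := by
    intro x y
    simp only [hτL, apply_ite star, star_neg, star_one, star_zero, (fermionTorusGraph 2 L).adj_comm x y]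
  have hK : 𝓚.IsHermitian := isHermitian_shibaOneBody hτsymm Δ μ U
  have hh₀h : h₀.IsHermitian := isHermitian_bdgNambuMatrix hτsymm _ μ
  have hV : (𝓚 - h₀).IsHermitian := hK.sub hh₀h
  have hsplit : h₀ + (𝓚 - h₀) = 𝓚 := by abel
  -- the weight and the constants of the stability theorem
  set g : TorusSite 2 L → ℝ := fun w => ((1 + (Torus.tnorm w : ℝ)) ^ 4)⁻¹ with hg
  set w : Orb (FermionTorus 2 L) → Orb (FermionTorus 2 L) → ℝ := fun o o' =>
    C * g (FermionTorus.toTorusSite (ofLex o).1 - FermionTorus.toTorusSite (ofLex o').1) with hw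
  have hwpos : ∀ o o', 0 < w o o' := fun o o' => by positivity
  set SL : ℝ := ∑ z : TorusSite 2 L, g z with hSL
  have hSLS : SL ≤ S := sum_inv_one_add_tnorm_pow_le_tsum (L := L) le_rfl
  have hSL0 : 0 ≤ SL := sum_nonneg fun z _ => by positivity
  set c : ℝ := (2 : ℝ) ^ (4 + 2) * C * SL * (2 * |U| + (2 : ℝ) ^ (4 + 3) * Real.sqrt 2 * |h|) with hc
  -- `β c ≤ 1/2`
  have hsqrt : Real.sqrt 2 ≤ 3 / 2 := by
    rw [show (3 / 2 : ℝ) = Real.sqrt ((3 / 2) ^ 2) by rw [Real.sqrt_sq (by norm_num)]]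
    exact Real.sqrt_le_sqrt (by norm_num)
  have hAκ : 2 * |U| + (2 : ℝ) ^ (4 + 3) * Real.sqrt 2 * |h| ≤ 200 * κ := by
    have h1 : Real.sqrt 2 * |h| ≤ 3 / 2 * κ := mul_le_mul hsqrt hh (abs_nonneg _) (by norm_num)
    have h2 : (2 : ℝ) ^ (4 + 3) = 128 := by norm_num
    rw [h2, mul_assoc]
    linarith
  have hcle : c ≤ (2 : ℝ) ^ 6 * C * S * (200 * κ) := by
    rw [hc, show (2 : ℝ) ^ (4 + 2) = 2 ^ 6 by norm_num]
    have hA0 : 0 ≤ 2 * |U| + (2 : ℝ) ^ (4 + 3) * Real.sqrt 2 * |h| := by positivity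
    gcongr
  have hθ : β * c ≤ 1 / 2 := by
    have hden : 0 < 2 * (2 : ℝ) ^ 6 * (C * S + 1) * 200 * (β + 1) := by positivity
    have h2 : β * ((2 : ℝ) ^ 6 * C * S * (200 * κ)) ≤ 1 / 2 := by
      rw [hκ, show β * ((2 : ℝ) ^ 6 * C * S * (200 * (2 * 2 ^ 6 * (C * S + 1) * 200 * (β + 1))⁻¹)) =
        (β * (2 ^ 6 * C * S * 200)) / (2 * 2 ^ 6 * (C * S + 1) * 200 * (β + 1)) by ring,
        div_le_iff₀ hden]
      nlinarith [mul_nonneg hCpos.le hS0, mul_nonneg hβ (mul_nonneg hCpos.le hS0)]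
    calc β * c ≤ β * ((2 : ℝ) ^ 6 * C * S * (200 * κ)) := mul_le_mul_of_nonneg_left hcle hβ
      _ ≤ 1 / 2 := h2
  have hθ1 : β * c < 1 := by linarith
  -- the free kernel bound and the sub-convolutivity
  have hΓ₀ : ∀ τ' ∈ Icc (0:ℝ) β, ∀ o o' : Orb (FermionTorus 2 L),
      ‖(exp ((-τ') • h₀) * (1 + exp ((-β) • h₀))⁻¹) o o'‖ ≤ w o o' := by
    intro τ' hτ' o o'
    obtain ⟨⟨y, s'⟩, rfl⟩ : ∃ p : FermionTorus 2 L × Fin 2, toLex p = o := ⟨ofLex o, toLex_ofLex o⟩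
    obtain ⟨⟨x, s⟩, rfl⟩ : ∃ p : FermionTorus 2 L × Fin 2, toLex p = o' := ⟨ofLex o', toLex_ofLex o'⟩
    exact norm_shibaFreeKernel_apply_le β μ hβ hCpos.le hC hL hτ' x y s s'
  have hconv : ∀ o o' : Orb (FermionTorus 2 L),
      ∑ k, ∑ l, w o k * ‖(𝓚 - h₀) k l‖ * w l o' ≤ c * w o o' :=
    fun o o' => shibaPerturbation_subconvolutive (L := L) 4 μ h U C hCpos.le o o'
  -- the stability theorem
  have key := Matrix.norm_thermalKernel_apply_le_of_subconvolutive hh₀h hV hβ w hwpos hΓ₀ hconv hθ1 τ hτ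
    (orb v σ') (orb u σ)
  rw [hsplit] at key
  refine key.trans ?_
  -- `w / (1 - βc) ≤ 2 w`
  have hwval : w (orb v σ') (orb u σ) = C * g (FermionTorus.toTorusSite v - FermionTorus.toTorusSite u) := rfl
  rw [div_le_iff₀ (by linarith), hwval]
  have hgv : 0 ≤ C * g (FermionTorus.toTorusSite v - FermionTorus.toTorusSite u) := by positivity
  nlinarith

end Decay

end Literature.MathematicalPhysics.QuantumLattice
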